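import Literature.NumberTheory.EllipticCurves.PAdicLambdaCertificateProofs
import Literature.NumberTheory.EllipticCurves.GreenbergVatsal2000.CharacterPAdicLFunctionCProofs
import Literature.NumberTheory.EllipticCurves.KubotaLeopoldtIwasawaFunctionProofs
import Literature.NumberTheory.EllipticCurves.PAdicMeasureTwistedMomentsProofs
import HarnessLib

/-!
# Greenberg–Vatsal 2000 §3 (26)/(27): the `λ`-CERTIFICATES of `L_{Σ₀}(C ⊗ χ, T)` and `L_{Σ₀}(D ⊗ χ, T)`
# from `a + 1` interpolation values — `ord_T(g mod p) = a` by divided differences at the nodes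
# `T = κ(γ)^{k} − 1` (resp. `κ(γ)^{−k} − 1`), `k = 0, …, a` (THEOREMS)

HONEST FRAMING (cell `bsd-eis`, seat `bsd-eis-x3` gen 3): theorems only, no named fact. The per-pair
ANALYTIC certificates `hCcert : ord_T(L_{Σ₀}(C ⊗ χ, T) mod p) = a`, `hDcert : ord_T(L_{Σ₀}(D ⊗ χ, T) mod p) = b`
of the X3 certificate road (`Summits/…/Additive/X3BranchResidualCountOfCharacterFacts.lean`) concern
elements of `Λ` known ONLY through `IsCharacterLFunctionC/D` (their values `characterLValueC/D p θ Σ₀ k`,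
`k ≥ 1`, generalized Bernoulli numbers — GV (26)/(27) with Lang Ch. 4 Thm. 3.2). This file makes them
FINITE checks: by the divided-difference kernel `order_toNat_eq_of_lagrangeSum`
(`PAdicLambdaCertificateProofs.lean`; Greenberg 2001 §4 p. 356) at the nodes `x_k = κ(γ)^{±k} − 1 ∈ pℤ_p`
(`k = 0, …, a`, pairwise distinct), `ord_T(g mod p) = a` follows from the `p`-adic norms of the `a + 1`
Lagrange sums `L_j = ∑_{i≤j} V_{i+1} / ∏_{k≤j, k≠i} (x_i − x_k)`, `V_k = characterLValueC/D p θ Σ₀ k`: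
`‖L_j‖ < 1` for `j < a` and `‖L_a‖ ≥ 1`. At `p = 3` (all characters quadratic, Teichmüller lifts `±1`)
these are statements about RATIONAL numbers.

* `order_toNat_eq_of_isCharacterLFunctionC_of_lagrange`, `order_toNat_eq_of_isCharacterLFunctionD_of_lagrange`;
* `teichmullerLift_neg_one` (`ω(−1) = −1`, `p` odd) and `teichmullerLift_three` (at `p = 3` the
  Teichmüller lift takes the values `0, 1, −1`), which make `characterLValueC/D 3 θ Σ₀ k` explicit
  RATIONAL generalized-Bernoulli sums for the display generator.

References: [GreenbergVatsal2000] §3 pp. 41–42 ((26), (27)); [Greenberg2001PastPresent] §4 pp. 355–356;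
[LangCyclotomic1990] Ch. 4 §1, §3.
-/

noncomputable section

open scoped Classical

open Finset NumberField IsDedekindDomain Literature.NumberTheory.EllipticCurves

namespace Literature.NumberTheory.EllipticCurves.GreenbergVatsal2000

open CyclotomicZp

variable (p : ℕ) [Fact p.Prime] {m d : ℕ} (φ : DirichletCharacter (ZMod p) m)
  (ψ : DirichletCharacter (ZMod p) d) (S₀ : Finset (HeightOneSpectrum (𝓞 ℚ)))

/-- The nodes `κ(γ)^i − 1` (`i ≤ a`) are pairwise distinct in `ℚ_p` (`κ(γ) = 1 + p^{e₀} ≥ 2`). [folklore] -/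
private theorem injOn_cyclotomicGenerator_pow_sub_one (a : ℕ) :
    Set.InjOn (fun i : ℕ ↦ ((cyclotomicGenerator p : ℕ) : ℚ_[p]) ^ i - 1) (range (a + 1) : Finset ℕ) := by
  intro i _ j _ hij
  have h1 : ((cyclotomicGenerator p : ℕ) : ℚ_[p]) ^ i = ((cyclotomicGenerator p : ℕ) : ℚ_[p]) ^ j :=
    sub_left_injective hij
  have h2 : (cyclotomicGenerator p) ^ i = (cyclotomicGenerator p) ^ j := by exact_mod_cast h1
  have hκ : 2 ≤ cyclotomicGenerator p := by
    have h1 : 1 ≤ p ^ cyclotomicExponent p := Nat.one_le_pow _ _ (Fact.out : p.Prime).pos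
    unfold cyclotomicGenerator
    omega
  exact Nat.pow_right_injective hκ h2

/-- The nodes `κ(γ)^{−i} − 1` (`i ≤ a`) are pairwise distinct in `ℚ_p`. [folklore] -/
private theorem injOn_cyclotomicGenerator_inv_pow_sub_one (a : ℕ) :
    Set.InjOn (fun i : ℕ ↦ (((cyclotomicGenerator p : ℕ) : ℚ_[p])⁻¹) ^ i - 1)
      (range (a + 1) : Finset ℕ) := by
  intro i hi j hj hij
  have h1 : (((cyclotomicGenerator p : ℕ) : ℚ_[p])⁻¹) ^ i = (((cyclotomicGenerator p : ℕ) : ℚ_[p])⁻¹) ^ j :=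
    sub_left_injective hij
  rw [inv_pow, inv_pow, inv_inj] at h1
  exact injOn_cyclotomicGenerator_pow_sub_one p a hi hj (by simp only [h1])

/-- **`λ`-certificate for `L_{Σ₀}(C ⊗ χ, T)`** (GV (26): `g(κ(γ)^{k−1} − 1) = characterLValueC p φ Σ₀ k`):
with the nodes `x_i = κ(γ)^i − 1` and values `V_{i+1}` (`i = 0, …, a`), if the Lagrange divided
differences satisfy `‖L_j‖ < 1` (`j < a`) and `‖L_a‖ ≥ 1`, then `ord_T(g mod p) = a`.
[cite: GreenbergVatsal2000, §3 p. 41 (26)] [cite: Greenberg2001PastPresent, §4 p. 356] -/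
theorem order_toNat_eq_of_isCharacterLFunctionC_of_lagrange {g : IwasawaAlgebra p}
    (hg : IsCharacterLFunctionC p φ S₀ g) {a : ℕ}
    (hlt : ∀ j < a, ‖∑ i ∈ range (j + 1), characterLValueC p φ S₀ (i + 1) /
        ∏ k ∈ (range (j + 1)).erase i,
          ((((cyclotomicGenerator p : ℕ) : ℚ_[p]) ^ i - 1) -
            (((cyclotomicGenerator p : ℕ) : ℚ_[p]) ^ k - 1))‖ < 1)
    (hge : 1 ≤ ‖∑ i ∈ range (a + 1), characterLValueC p φ S₀ (i + 1) /
        ∏ k ∈ (range (a + 1)).erase i,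
          ((((cyclotomicGenerator p : ℕ) : ℚ_[p]) ^ i - 1) -
            (((cyclotomicGenerator p : ℕ) : ℚ_[p]) ^ k - 1))‖) :
    (PowerSeries.map (PadicInt.toZMod (p := p)) g).order.toNat = a := by
  set x : ℕ → ℤ_[p] := fun i ↦ cycPow p (i : ℤ_[p]) - 1 with hx
  have hxc : ∀ i, (x i : ℚ_[p]) = ((cyclotomicGenerator p : ℕ) : ℚ_[p]) ^ i - 1 := fun i ↦ by
    rw [hx]; push_cast; rw [coe_cycPow_natCast]
  have hxn : ∀ i, ‖x i‖ < 1 := fun i ↦ by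
    rw [← PadicInt.padic_norm_e_of_padicInt, hxc]; exact norm_cyclotomicGenerator_pow_sub_one_lt i
  have hinj : Set.InjOn (fun i ↦ (x i : ℚ_[p])) (range (a + 1) : Finset ℕ) := by
    simp only [hxc]; exact injOn_cyclotomicGenerator_pow_sub_one p a
  have hv : ∀ i ∈ range (a + 1), HasSum (fun n ↦ ((PowerSeries.coeff n g : ℤ_[p]) : ℚ_[p]) *
      (x i : ℚ_[p]) ^ n) (characterLValueC p φ S₀ (i + 1)) := fun i _ ↦ by
    have h := hg (i + 1) (by omega)
    rw [Nat.add_sub_cancel] at h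
    simp only [hxc]; exact h
  refine order_toNat_eq_of_lagrangeSum x hxn hinj (fun i ↦ characterLValueC p φ S₀ (i + 1)) hv ?_ ?_
  · intro j hj; simp only [hxc]; exact hlt j hj
  · simp only [hxc]; exact hge

/-- **`λ`-certificate for `L_{Σ₀}(D ⊗ χ, T)`** (GV (27): `g(κ(γ)^{1−k} − 1) = characterLValueD p ψ Σ₀ k`):
with the nodes `x_i = κ(γ)^{−i} − 1` and values `V_{i+1}` (`i = 0, …, a`), if `‖L_j‖ < 1` (`j < a`) and
`‖L_a‖ ≥ 1`, then `ord_T(g mod p) = a`. [cite: GreenbergVatsal2000, §3 p. 42 (27)]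
[cite: Greenberg2001PastPresent, §4 p. 356] -/
theorem order_toNat_eq_of_isCharacterLFunctionD_of_lagrange {g : IwasawaAlgebra p}
    (hg : IsCharacterLFunctionD p ψ S₀ g) {a : ℕ}
    (hlt : ∀ j < a, ‖∑ i ∈ range (j + 1), characterLValueD p ψ S₀ (i + 1) /
        ∏ k ∈ (range (j + 1)).erase i,
          (((((cyclotomicGenerator p : ℕ) : ℚ_[p])⁻¹) ^ i - 1) -
            ((((cyclotomicGenerator p : ℕ) : ℚ_[p])⁻¹) ^ k - 1))‖ < 1)
    (hge : 1 ≤ ‖∑ i ∈ range (a + 1), characterLValueD p ψ S₀ (i + 1) /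
        ∏ k ∈ (range (a + 1)).erase i,
          (((((cyclotomicGenerator p : ℕ) : ℚ_[p])⁻¹) ^ i - 1) -
            ((((cyclotomicGenerator p : ℕ) : ℚ_[p])⁻¹) ^ k - 1))‖) :
    (PowerSeries.map (PadicInt.toZMod (p := p)) g).order.toNat = a := by
  set x : ℕ → ℤ_[p] := fun i ↦ cycPow p (-(i : ℤ_[p])) - 1 with hx
  have hxc : ∀ i, (x i : ℚ_[p]) = (((cyclotomicGenerator p : ℕ) : ℚ_[p])⁻¹) ^ i - 1 := fun i ↦ by
    rw [hx]; push_cast; rw [coe_cycPow_neg_natCast]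
  have hxn : ∀ i, ‖x i‖ < 1 := fun i ↦ by
    rw [← PadicInt.padic_norm_e_of_padicInt, hxc]; exact norm_cyclotomicGenerator_inv_pow_sub_one_lt i
  have hinj : Set.InjOn (fun i ↦ (x i : ℚ_[p])) (range (a + 1) : Finset ℕ) := by
    simp only [hxc]; exact injOn_cyclotomicGenerator_inv_pow_sub_one p a
  have hv : ∀ i ∈ range (a + 1), HasSum (fun n ↦ ((PowerSeries.coeff n g : ℤ_[p]) : ℚ_[p]) *
      (x i : ℚ_[p]) ^ n) (characterLValueD p ψ S₀ (i + 1)) := fun i _ ↦ by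
    have h := hg (i + 1) (by omega)
    rw [Nat.add_sub_cancel] at h
    simp only [hxc]; exact h
  refine order_toNat_eq_of_lagrangeSum x hxn hinj (fun i ↦ characterLValueD p ψ S₀ (i + 1)) hv ?_ ?_
  · intro j hj; simp only [hxc]; exact hlt j hj
  · simp only [hxc]; exact hge

/-! ## Teichmüller lifts at `−1` and at `p = 3` (the values entering `characterLValueC/D`) -/

/-- **`ω(−1) = −1`** for `p` odd: `ω(−1)² = ω(1) = 1` and `ω(−1) ≡ −1 ≢ 1 (mod p)`.
[cite: LangCyclotomic1990, Ch. 1 §2 (the Teichmüller character)] -/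
theorem teichmullerLift_neg_one (hp : p ≠ 2) : teichmullerLift p (-1) = -1 := by
  have pp : p.Prime := Fact.out
  set y : ℤ_[p] := teichmullerLift p (-1) with hy
  have hsq : y * y = 1 := by
    rw [hy, ← teichmullerLift_mul, neg_mul_neg, one_mul, teichmullerLift_one]
  have hred : PadicInt.toZMod y = -1 := by rw [hy, toZMod_teichmullerLift]
  have hfac : (y - 1) * (y + 1) = 0 := by linear_combination hsq
  rcases mul_eq_zero.mp hfac with h1 | h1
  · exfalso
    have hy1 : y = 1 := by linear_combination h1
    rw [hy1, map_one] at hred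
    have h2 : (2 : ZMod p) = 0 := by linear_combination hred
    have h2' : ((2 : ℕ) : ZMod p) = 0 := by exact_mod_cast h2
    rw [ZMod.natCast_eq_zero_iff] at h2'
    exact hp ((Nat.prime_dvd_prime_iff_eq pp Nat.prime_two).mp h2')
  · linear_combination h1

/-- **At `p = 3`: `ω(0) = 0`, `ω(1) = 1`, `ω(2) = −1`** — every value of an `𝔽₃`-valued character lifts
to `0` or `±1 ∈ ℤ₃`, so the generalized Bernoulli sums `characterLValueC/D 3 θ Σ₀ k` are explicit
rational numbers. [cite: LangCyclotomic1990, Ch. 1 §2 (the Teichmüller character)] -/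
theorem teichmullerLift_three (x : ZMod 3) :
    teichmullerLift 3 x = if x = 0 then 0 else if x = 1 then 1 else -1 := by
  by_cases h0 : x = 0
  · rw [if_pos h0, h0]; exact teichmullerLift_zero
  rw [if_neg h0]
  by_cases h1 : x = 1
  · rw [if_pos h1, h1]; exact teichmullerLift_one 3
  rw [if_neg h1]
  have hx : x = -1 := by
    have hv : x.val < 3 := x.val_lt
    have h0' : x.val ≠ 0 := fun h ↦ h0 ((ZMod.val_eq_zero x).mp h)
    have h1' : x.val ≠ 1 := fun h ↦ h1 (by rw [← ZMod.natCast_zmod_val x, h, Nat.cast_one])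
    have h2 : x.val = 2 := by omega
    have h2' : ((2 : ℕ) : ZMod 3) = -1 := by decide
    rw [← ZMod.natCast_zmod_val x, h2, h2']
  rw [hx]
  exact teichmullerLift_neg_one 3 (by decide)

end Literature.NumberTheory.EllipticCurves.GreenbergVatsal2000

end
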